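import Literature.IUT.LogVolume.Corollary22Arithmetic
import HarnessLib

/-!
# The fork at [IUTchIII] Corollary 3.12 — checks: the hypothesis structure of the [IUTchIV] Cor. 2.2 (ii)
# arithmetic is satisfiable (non-vacuity)

Record-only file (D-0012) of the abc-iut cell; TAKES NO SIDE. `Literature/IUT/LogVolume/Corollary22Arithmetic.lean`
derives condition (C2) (`Cor22.Data.condition_C2`, under `ε_E ≤ 1`) and `ε_E > 1 ⟹ h < (16/ε_d)³·(60δ)^{4+ε_d}`
from the printed inputs bundled in `Cor22.Data` (ranges of `s = h^{1/2}`, `δ`, `l`; the Thm. 1.10 display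
`disp`; the `q`-parameter comparisons `Q1`, `Q2`). This file exhibits a toy instance (`s = l = 10⁷`, `δ = 2`,
`d_mod = e* = L = η = log q = log q^{∤2} = 0`, `B = s²/6`) which moreover satisfies the side conditions of
`condition_C2` (`ε_E ≤ 1`, `log q ≤ log q^{∤2} ≤ h`), so those hypotheses are jointly satisfiable. The toy
numbers are NOT invariants of any curve (referee vacuity check only).
-/

noncomputable section

namespace Summit.ABC

namespace IUTFork

open Literature.IUT.LogVolume

/-- `log(4·10¹⁴) ≤ 49` (via `4·10¹⁴ ≤ 2⁴⁹` and `log 2 < 1`). [folklore] -/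
private theorem log_4e14_le : Real.log (2 * 2 * (10 ^ 7 : ℝ) ^ 2) ≤ 49 := by
  have h2 : Real.log 2 < 1 := by have := Real.log_two_lt_d9; linarith
  calc Real.log (2 * 2 * (10 ^ 7 : ℝ) ^ 2) ≤ Real.log ((2 : ℝ) ^ 49) :=
        Real.log_le_log (by positivity) (by norm_num)
    _ = 49 * Real.log 2 := by rw [Real.log_pow]; norm_num
    _ ≤ 49 := by nlinarith

/-- `1 ≤ log(4·10¹⁴)`. [folklore] -/
private theorem one_le_log_4e14 : 1 ≤ Real.log (2 * 2 * (10 ^ 7 : ℝ) ^ 2) := by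
  rw [← Real.log_exp 1]
  exact Real.log_le_log (Real.exp_pos 1) (by have := Real.exp_one_lt_d9; norm_num at this ⊢; linarith)

/-- A toy instance of the Cor. 2.2 (ii) input bundle. [claim: Mochizuki2012, status: disputed] -/
def toyCor22Data : Cor22.Data where
  s := 10 ^ 7
  five_le_s := by norm_num
  δ := 2
  two_le_δ := le_rfl
  l := 10 ^ 7
  P1lo := le_rfl
  P1hi := by nlinarith [one_le_log_4e14]
  L := 0
  L_nonneg := le_rfl
  η := 0
  η_nonneg := le_rfl
  B := (10 ^ 7) ^ 2 / 6
  B_nonneg := by positivity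
  logq := 0
  logq2 := 0
  dmod := 0
  dmod_nonneg := le_rfl
  twenty_dmod_le := by norm_num
  estar := 0
  estar_nonneg := le_rfl
  estar_le := by norm_num
  disp := by norm_num
  Q1 := by
    have : (0 : ℝ) ≤ Real.log (10 ^ 7) := Real.log_nonneg (by norm_num)
    norm_num
    positivity
  Q2 := by norm_num

/-- For the toy instance `ε_E ≤ 1`. [claim: Mochizuki2012, status: disputed] -/
theorem toy_epsE_le_one : Cor22.epsE toyCor22Data.δ toyCor22Data.s ≤ 1 := by
  unfold Cor22.epsE toyCor22Data
  simp only
  have h := log_4e14_le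
  have h0 : 0 ≤ Real.log (2 * 2 * (10 ^ 7 : ℝ) ^ 2) := by linarith [one_le_log_4e14]
  calc (60 * 2) ^ 2 / (10 ^ 7 : ℝ) * Real.log (2 * 2 * (10 ^ 7 : ℝ) ^ 2)
      ≤ (60 * 2) ^ 2 / (10 ^ 7 : ℝ) * 49 := by gcongr
    _ ≤ 1 := by norm_num

/-- **Non-vacuity of the Cor. 2.2 (ii) arithmetic**: the input bundle `Cor22.Data` together with the side
conditions of `condition_C2` (`ε_E ≤ 1`, `log q ≤ log q^{∤2} ≤ h = s²`) is jointly satisfiable.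
[claim: Mochizuki2012, status: disputed] -/
theorem cor22Data_satisfiable :
    ∃ A : Cor22.Data, Cor22.epsE A.δ A.s ≤ 1 ∧ A.logq ≤ A.logq2 ∧ A.logq2 ≤ A.s ^ 2 :=
  ⟨toyCor22Data, toy_epsE_le_one, le_rfl, by simp [toyCor22Data]⟩

end IUTFork

end Summit.ABC

end
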